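import Summits.AnomalousDissipation.AnomalousDissipation.Theorems.TaylorCertificatePair.Negative.Ceiling

/-!
# Two unresolved modes dressed on rest (negative side of `KolmogorovFloor`, stmt-AnomalousDissipation-14030)

cdisprove seat `refuter-cdisprove-stmt-AnomalousDissipation-14030-0` (2026-08-16). Fourier bookkeeping of the
two-mode state `Re(e_p ⊗ z_A) + Re(e_{p+q} ⊗ z_B)` with `|p|, |p+q| > N` against a band-limited cylindrical
functional: the state is invisible to the coordinates (`coords_two_eq`), to the Laplacian of the multiplier
(`laplacian_two`), and its inertial term reduces to the single beat at `q` (`inertial_two`); negating both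
polarisations negates the pairing with the force (`pairing_two_neg`) and keeps everything else. The FLOOR
inequality at such a state then bounds the beat gain by the injection at rest plus the viscous price of the
waves (`floor_beat_at_rest`) — the floor-side analogue of the landed `ceil_beat`. Used by
`Negative/BeatAtRest.lean` (`not_floor_sixth`). Toolkit: `Theorems/TaylorCertificatePair/Negative/*`.
-/

noncomputable section

open MeasureTheory UnitAddTorus Matrix
open scoped InnerProductSpace ENNReal ComplexConjugate

namespace Summit.AnomalousDissipation.AnomalousDissipation.Theorems.KolmogorovFloor.Negative

open Literature.Analysis.FunctionSpaces Literature.Analysis.FluidPDE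
open Summit.AnomalousDissipation.AnomalousDissipation.Theorems.TaylorCertificatePair.Negative

/-! ### Two-mode states: algebra in Fourier variables -/

/-- `dotc κ (-z) = - dotc κ z`. -/
theorem dotc_neg_right (κ : Fin 3 → ℤ) (w : (EuclideanSpace ℂ (Fin 3))) :
    ((fun j => ((κ) j : ℂ)) ⬝ᵥ (WithLp.ofLp (-w))) = -((fun j => ((κ) j : ℂ)) ⬝ᵥ (WithLp.ofLp (w))) := by
  simp [dotProduct, Finset.sum_neg_distrib, mul_neg]

/-- Membership facts for the two-mode frequency vector. -/
theorem two_ne_zero' {p q : Fin 3 → ℤ} (hp : p ≠ 0) (hpq : p + q ≠ 0) :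
    ∀ m, (![p, p + q] : Fin 2 → (Fin 3 → ℤ)) m ≠ 0 := by
  intro m
  fin_cases m
  · exact hp
  · exact hpq

/-- Transversality of the two polarisations. -/
theorem two_dotc {p q : Fin 3 → ℤ} {zA zB : (EuclideanSpace ℂ (Fin 3))} (hA : ((fun j => ((p) j : ℂ)) ⬝ᵥ (WithLp.ofLp (zA))) = 0)
    (hB : ((fun j => (((p + q)) j : ℂ)) ⬝ᵥ (WithLp.ofLp (zB))) = 0) :
    ∀ m, ((fun j => ((((![p, p + q] : Fin 2 → (Fin 3 → ℤ)) m)) j : ℂ)) ⬝ᵥ (WithLp.ofLp (((![zA, zB] : Fin 2 → (EuclideanSpace ℂ (Fin 3))) m)))) = 0 := by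
  intro m
  fin_cases m
  · exact hA
  · exact hB

/-- Frequencies of the two-mode state are bounded by `L`. -/
theorem two_freq_le {p q : Fin 3 → ℤ} {L : ℕ}
    (hLp : Torus.freqNormSq p ≤ (L : ℝ) ^ 2) (hLpq : Torus.freqNormSq (p + q) ≤ (L : ℝ) ^ 2) :
    ∀ m, Torus.freqNormSq ((![p, p + q] : Fin 2 → (Fin 3 → ℤ)) m) ≤ (L : ℝ) ^ 2 := by
  intro m
  fin_cases m
  · exact hLp
  · exact hLpq

/-- **The beat of two unresolved modes.** Inertial term of the two-mode state `p`, `p' = p + q` against a smooth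
band-limited `G`: only the `(p, p')` interaction at the resolved beat frequency `q` survives. -/
theorem inertial_two {G : (UnitAddTorus (Fin 3)) → (EuclideanSpace ℝ (Fin 3))} (hG : Torus.IsSmooth G) (p q : Fin 3 → ℤ) (zA zB : (EuclideanSpace ℂ (Fin 3)))
    (hA : ((fun j => ((p) j : ℂ)) ⬝ᵥ (WithLp.ofLp (zA))) = 0) (hB : ((fun j => (((p + q)) j : ℂ)) ⬝ᵥ (WithLp.ofLp (zB))) = 0)
    (hBq : ((fun j => ((q) j : ℂ)) ⬝ᵥ (WithLp.ofLp (zB))) = 0)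
    (h9 : (mFourierCoeff (EuclideanSpace.complexify ∘ G) (p + (p + q))) = 0) (h10 : (mFourierCoeff (EuclideanSpace.complexify ∘ G) ((p + q) + p)) = 0) :
    ∫ x, ⟪Torus.fderiv G x ((∑ mm, Torus.realTrigPoly {![p, p + q] mm} (fun _ => ![zA, zB] mm)) x),
        (∑ mm, Torus.realTrigPoly {![p, p + q] mm} (fun _ => ![zA, zB] mm)) x⟫_ℝ =
      Real.pi * (conj (((fun j => ((q) j : ℂ)) ⬝ᵥ (WithLp.ofLp (zA)))) * ⟪(mFourierCoeff (EuclideanSpace.complexify ∘ G) q), zB⟫_ℂ).im := by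
  rw [inertial_modes hG]
  have e1 : p + q - p = q := add_sub_cancel_left p q
  have e2' : p - (p + q) = -q := by abel
  have d11 : ((fun j => (((p + p)) j : ℂ)) ⬝ᵥ (WithLp.ofLp (zA))) = 0 := by rw [dotc_add_left, hA, add_zero]
  have d22 : ((fun j => (((p + q + (p + q))) j : ℂ)) ⬝ᵥ (WithLp.ofLp (zB))) = 0 := by rw [dotc_add_left, hB, add_zero]
  have hA2 : ((fun j => (((p + q - p)) j : ℂ)) ⬝ᵥ (WithLp.ofLp (zA))) = ((fun j => ((q) j : ℂ)) ⬝ᵥ (WithLp.ofLp (zA))) := by rw [e1]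
  have hBm : ((fun j => (((-q)) j : ℂ)) ⬝ᵥ (WithLp.ofLp (zB))) = 0 := by rw [dotc_neg_left, hBq, neg_zero]
  simp only [Fin.sum_univ_two, Matrix.cons_val_zero, Matrix.cons_val_one,
    sub_self, dotc_zero_left, d11, d22, hA2, e2', hBm, h9, h10, zero_mul, map_zero,
    inner_zero_left, Complex.zero_im, mul_zero, add_zero, zero_add]
  rw [e1]

/-- The Laplacian pairing of the two-mode state against a field with no coefficients at `p`, `p + q`: zero. -/
theorem laplacian_two {G : (UnitAddTorus (Fin 3)) → (EuclideanSpace ℝ (Fin 3))} (hG : Torus.IsSmooth G)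
    (zA zB : (EuclideanSpace ℂ (Fin 3))) {p q : Fin 3 → ℤ} (hp : (mFourierCoeff (EuclideanSpace.complexify ∘ G) p) = 0) (hpq : (mFourierCoeff (EuclideanSpace.complexify ∘ G) (p + q)) = 0) :
    ∫ x, ⟪(∑ mm, Torus.realTrigPoly {![p, p + q] mm} (fun _ => ![zA, zB] mm)) x, Torus.laplacian G x⟫_ℝ = 0 := by
  rw [integral_inner_modes_laplacian hG]
  simp only [Fin.sum_univ_two, Matrix.cons_val_zero, Matrix.cons_val_one, hp, hpq,
    smul_zero, neg_zero, inner_zero_right, Complex.zero_re, add_zero]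

/-- The pairing of the two-mode state with a smooth field, in Fourier variables. -/
theorem pairing_two {f : (UnitAddTorus (Fin 3)) → (EuclideanSpace ℝ (Fin 3))} (hf : Integrable f volume)
    (zA zB : (EuclideanSpace ℂ (Fin 3))) (p q : Fin 3 → ℤ) :
    ∫ x, ⟪(∑ mm, Torus.realTrigPoly {![p, p + q] mm} (fun _ => ![zA, zB] mm)) x, f x⟫_ℝ =
      (⟪zA, (mFourierCoeff (EuclideanSpace.complexify ∘ f) p)⟫_ℂ).re + (⟪zB, (mFourierCoeff (EuclideanSpace.complexify ∘ f) (p + q))⟫_ℂ).re := by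
  rw [integral_inner_modes_left hf]
  simp only [Fin.sum_univ_two, Matrix.cons_val_zero, Matrix.cons_val_one]

/-- Negating both polarisations negates the pairing with any field. -/
theorem pairing_two_neg {f : (UnitAddTorus (Fin 3)) → (EuclideanSpace ℝ (Fin 3))} (hf : Integrable f volume)
    (zA zB : (EuclideanSpace ℂ (Fin 3))) (p q : Fin 3 → ℤ) :
    ∫ x, ⟪(∑ mm, Torus.realTrigPoly {![p, p + q] mm} (fun _ => ![-zA, -zB] mm)) x, f x⟫_ℝ =
      -∫ x, ⟪(∑ mm, Torus.realTrigPoly {![p, p + q] mm} (fun _ => ![zA, zB] mm)) x, f x⟫_ℝ := by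
  rw [pairing_two hf, pairing_two hf, inner_neg_left, inner_neg_left, Complex.neg_re, Complex.neg_re]
  ring

/-- The coordinates of the two-mode state vanish (like those of rest): the waves are invisible. -/
theorem coords_two_eq (Φ : Torus.CylindricalTest (Fin 3)) {N : ℕ}
    (hΦ : ∀ i, Torus.fourierTruncate N (Φ.g i) = Φ.g i) {p q : Fin 3 → ℤ} {zA zB : (EuclideanSpace ℂ (Fin 3))}
    (hNp : (N : ℝ) ^ 2 < Torus.freqNormSq p) (hNpq : (N : ℝ) ^ 2 < Torus.freqNormSq (p + q))
    {uw : (Torus.energySpace (Fin 3))} (huw : (((uw : (Torus.energySpace (Fin 3))) : (Lp (EuclideanSpace ℝ (Fin 3)) 2 (volume : Measure (UnitAddTorus (Fin 3))))) : (UnitAddTorus (Fin 3)) → (EuclideanSpace ℝ (Fin 3))) =ᵐ[volume] (∑ mm, Torus.realTrigPoly {![p, p + q] mm} (fun _ => ![zA, zB] mm))) :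
    Φ.coords uw = Φ.coords 0 := by
  ext i
  rw [coords_of_ae huw, coords_of_ae coe_zero_ae, integral_inner_modes_left (Φ.g_smooth i).integrable]
  simp only [Fin.sum_univ_two, Matrix.cons_val_zero, Matrix.cons_val_one]
  rw [fc_g_eq_zero Φ hΦ i p hNp, fc_g_eq_zero Φ hΦ i (p + q) hNpq, inner_zero_right, inner_zero_right,
    Complex.zero_re, add_zero]
  simp



/-! ### FLOOR at the two-mode state dressed on rest -/

/-- **FLOOR at the beat state dressed on rest bounds the gain by the injection at rest plus the viscous price
of the waves**: if the two unresolved transversal modes `p`, `p + q` (with `(u_w, f) ≥ 0`, which the sign of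
the polarisations can always arrange) satisfy the floor inequality, then
`gain + ε₀ ≤ ‖f‖₂ 𝔊 + (1 + 2Θ) ν 4π² L² (2α)²`, where `-gain` bounds the beat, `𝔊` is the truncated `ℓ²`
coefficient norm of the multiplier at rest `G = Φ'(0)` and `L` bounds the wave frequencies. -/
theorem floor_beat_at_rest {f : (UnitAddTorus (Fin 3)) → (EuclideanSpace ℝ (Fin 3))} (hf : Torus.IsSmooth f) {ν F : ℝ} (hν : 0 < ν)
    (hFf : Real.sqrt (∫ x, ‖f x‖ ^ 2) = F)
    (Φ : Torus.CylindricalTest (Fin 3)) {N : ℕ} (hΦ : ∀ i, Torus.fourierTruncate N (Φ.g i) = Φ.g i)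
    {θ Θ ε₀ : ℝ} (hθ : -Θ ≤ θ) (hθ' : θ ≤ 0)
    {p q : Fin 3 → ℤ} {zA zB : (EuclideanSpace ℂ (Fin 3))} {α : ℝ}
    (uw : (Torus.energySpace (Fin 3))) (huw : (((uw : (Torus.energySpace (Fin 3))) : (Lp (EuclideanSpace ℝ (Fin 3)) 2 (volume : Measure (UnitAddTorus (Fin 3))))) : (UnitAddTorus (Fin 3)) → (EuclideanSpace ℝ (Fin 3))) =ᵐ[volume] (∑ mm, Torus.realTrigPoly {![p, p + q] mm} (fun _ => ![zA, zB] mm)))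
    (hA : ((fun j => ((p) j : ℂ)) ⬝ᵥ (WithLp.ofLp (zA))) = 0) (hB : ((fun j => (((p + q)) j : ℂ)) ⬝ᵥ (WithLp.ofLp (zB))) = 0)
    (hBq : ((fun j => ((q) j : ℂ)) ⬝ᵥ (WithLp.ofLp (zB))) = 0)
    (hzA : ‖zA‖ ≤ α) (hzB : ‖zB‖ ≤ α)
    (hNp : (N : ℝ) ^ 2 < Torus.freqNormSq p) (hNpq : (N : ℝ) ^ 2 < Torus.freqNormSq (p + q))
    (hN5 : (N : ℝ) ^ 2 < Torus.freqNormSq (p + (p + q)))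
    {L : ℕ} (hL : ∀ m, Torus.freqNormSq ((![p, p + q] : Fin 2 → (Fin 3 → ℤ)) m) ≤ (L : ℝ) ^ 2)
    {gain : ℝ}
    (hbeat : Real.pi * (conj (((fun j => ((q) j : ℂ)) ⬝ᵥ (WithLp.ofLp (zA)))) * ⟪(mFourierCoeff (EuclideanSpace.complexify ∘ (Φ.grad 0)) q), zB⟫_ℂ).im ≤ -gain)
    (hsign : 0 ≤ ∫ x, ⟪(∑ mm, Torus.realTrigPoly {![p, p + q] mm} (fun _ => ![zA, zB] mm)) x, f x⟫_ℝ)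
    (hfloor : ε₀ ≤ ν * (Torus.eGradNormSq (((uw : (Torus.energySpace (Fin 3))) : (Lp (EuclideanSpace ℝ (Fin 3)) 2 (volume : Measure (UnitAddTorus (Fin 3))))) : (UnitAddTorus (Fin 3)) → (EuclideanSpace ℝ (Fin 3)))).toReal +
        Torus.nsGeneratorPairing ν f uw (Φ.grad uw) +
      2 * θ * (Torus.pairing ((uw : (Torus.energySpace (Fin 3))) : (Lp (EuclideanSpace ℝ (Fin 3)) 2 (volume : Measure (UnitAddTorus (Fin 3))))) f -
        ν * (Torus.eGradNormSq (((uw : (Torus.energySpace (Fin 3))) : (Lp (EuclideanSpace ℝ (Fin 3)) 2 (volume : Measure (UnitAddTorus (Fin 3))))) : (UnitAddTorus (Fin 3)) → (EuclideanSpace ℝ (Fin 3)))).toReal)) :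
    gain + ε₀ ≤ F * (Real.sqrt (∑ κ' ∈ Torus.freqBall N, ‖mFourierCoeff (EuclideanSpace.complexify ∘ (Φ.grad 0)) κ'‖ ^ 2)) +
      (1 + 2 * Θ) * (ν * (4 * Real.pi ^ 2 * (L : ℝ) ^ 2 * (α + α) ^ 2)) := by
  set G := Φ.grad 0 with hGdef
  have hG : Torus.IsSmooth G := isSmooth_grad Φ 0
  have hband : ∀ κ, (N : ℝ) ^ 2 < Torus.freqNormSq κ →
      mFourierCoeff (EuclideanSpace.complexify ∘ G) κ = 0 := fc_grad_eq_zero Φ hΦ 0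
  have hband' : ∀ κ, (N : ℝ) ^ 2 < Torus.freqNormSq κ → (mFourierCoeff (EuclideanSpace.complexify ∘ G) κ) = 0 := hband
  -- the dressed state has the differential of rest
  have hgrad : Φ.grad uw = G := by
    rw [hGdef]
    exact grad_eq_of_coords_eq Φ (coords_two_eq Φ hΦ hNp hNpq huw)
  rw [hgrad, nsGeneratorPairing_of_ae huw, pairing_of_ae huw, eGradNormSq_congr_ae' huw] at hfloor
  have hα : 0 ≤ α := (norm_nonneg zA).trans hzA
  have hsum : ∑ m, ‖(![zA, zB] : Fin 2 → (EuclideanSpace ℂ (Fin 3))) m‖ ≤ α + α := by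
    simp only [Fin.sum_univ_two, Matrix.cons_val_zero, Matrix.cons_val_one]
    linarith
  have hsum0 : 0 ≤ ∑ m, ‖(![zA, zB] : Fin 2 → (EuclideanSpace ℂ (Fin 3))) m‖ := Finset.sum_nonneg fun m _ => norm_nonneg _
  -- (1) forcing term at rest
  have h1 : ∫ x, ⟪f x, G x⟫_ℝ ≤ F * (Real.sqrt (∑ κ' ∈ Torus.freqBall N, ‖mFourierCoeff (EuclideanSpace.complexify ∘ G) κ'‖ ^ 2)) := by
    have := integral_inner_le_coeffNorm (hf.memLp 2) hG.continuous hband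
    rwa [hFf] at this
  -- (2) Laplacian term: the waves are invisible to `ΔG`
  have h2 : ∫ x, ⟪(∑ mm, Torus.realTrigPoly {![p, p + q] mm} (fun _ => ![zA, zB] mm)) x, Torus.laplacian G x⟫_ℝ = 0 :=
    laplacian_two hG zA zB (hband' p hNp) (hband' (p + q) hNpq)
  -- (3) the beat
  have h3 : ∫ x, ⟪Torus.fderiv G x ((∑ mm, Torus.realTrigPoly {![p, p + q] mm} (fun _ => ![zA, zB] mm)) x),
      (∑ mm, Torus.realTrigPoly {![p, p + q] mm} (fun _ => ![zA, zB] mm)) x⟫_ℝ ≤ -gain := by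
    rw [inertial_two hG p q zA zB hA hB hBq (hband' _ hN5) (hband' _ (by rwa [add_comm]))]
    exact hbeat
  -- (4) the viscous price of the waves
  have hint : ∫ x, ‖(∑ mm, Torus.realTrigPoly {![p, p + q] mm} (fun _ => ![zA, zB] mm)) x‖ ^ 2 ≤ (α + α) ^ 2 :=
    integral_norm_sq_modes_le.trans (pow_le_pow_left₀ hsum0 hsum 2)
  have h5 : 0 ≤ ν * (Torus.eGradNormSq ((∑ mm, Torus.realTrigPoly {![p, p + q] mm} (fun _ => ![zA, zB] mm)))).toReal := by
    positivity
  have h6 : ν * (Torus.eGradNormSq ((∑ mm, Torus.realTrigPoly {![p, p + q] mm} (fun _ => ![zA, zB] mm)))).toReal ≤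
      ν * (4 * Real.pi ^ 2 * (L : ℝ) ^ 2 * (α + α) ^ 2) := by
    refine mul_le_mul_of_nonneg_left ?_ hν.le
    exact (toReal_eGradNormSq_modes_le hL).trans (mul_le_mul_of_nonneg_left hint (by positivity))
  -- (5) the energy channel: injection signed away, dissipation priced by `2Θ`
  have hΘ : 0 ≤ Θ := by linarith
  have h7 : 2 * θ * ((∫ x, ⟪(∑ mm, Torus.realTrigPoly {![p, p + q] mm} (fun _ => ![zA, zB] mm)) x, f x⟫_ℝ) -
      ν * (Torus.eGradNormSq ((∑ mm, Torus.realTrigPoly {![p, p + q] mm} (fun _ => ![zA, zB] mm)))).toReal) ≤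
      2 * Θ * (ν * (4 * Real.pi ^ 2 * (L : ℝ) ^ 2 * (α + α) ^ 2)) := by
    have ha : 2 * θ * (∫ x, ⟪(∑ mm, Torus.realTrigPoly {![p, p + q] mm} (fun _ => ![zA, zB] mm)) x, f x⟫_ℝ) ≤ 0 := by
      nlinarith
    have hb : -(2 * θ) * (ν * (Torus.eGradNormSq ((∑ mm, Torus.realTrigPoly {![p, p + q] mm} (fun _ => ![zA, zB] mm)))).toReal) ≤
        2 * Θ * (ν * (4 * Real.pi ^ 2 * (L : ℝ) ^ 2 * (α + α) ^ 2)) := by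
      calc -(2 * θ) * (ν * (Torus.eGradNormSq ((∑ mm, Torus.realTrigPoly {![p, p + q] mm} (fun _ => ![zA, zB] mm)))).toReal)
          ≤ (2 * Θ) * (ν * (Torus.eGradNormSq ((∑ mm, Torus.realTrigPoly {![p, p + q] mm} (fun _ => ![zA, zB] mm)))).toReal) :=
            mul_le_mul_of_nonneg_right (by linarith) h5
        _ ≤ 2 * Θ * (ν * (4 * Real.pi ^ 2 * (L : ℝ) ^ 2 * (α + α) ^ 2)) := mul_le_mul_of_nonneg_left h6 (by positivity)
    nlinarith
  -- assemble
  rw [h2, mul_zero, add_zero] at hfloor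
  nlinarith [hfloor, h1, h3, h6, h7]


end Summit.AnomalousDissipation.AnomalousDissipation.Theorems.KolmogorovFloor.Negative
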